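import Summits.HodgeConjecture.HodgeConjecture.Theorems.F0P3KitOfRecordLettersV8Cot    -- ★ (ED. 5 K9α-cot) → ★ `F0P3KitOfRecordLawsV8` p825117: `laws₈_kitOfRecord_of₄`'s in-house rows, `SpecPkg`, `factorisation_of_cls_of_pk`, `localIsotypyFin₈_kitOfRecord`
import Summits.HodgeConjecture.HodgeConjecture.Theorems.F0P3KitFamilyOfRecordW        -- ★6 (w1) (this pen): `FrameDataW`, `kitFamilyOfRecordW`, `isPinned_kitFamilyOfRecordW` (+ ★1 `kitOfRecordW`)
import HarnessLib

/-!
# Crux `H413` — closer ED. 38 «PK-ε», ★6 «REL♯-W» (w2): **the v8 `Laws` and the HJ3a LETTERS at the W-kit ∕ W-family of record**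

F0∕P3 «U3-mult», cell `hodgecm-mathlib`, crux H413 (`stmt-HodgeConjecture-24833`); RULING D53-pre PART A (4) ★6 (w2) as worded by the desk heir F0P3-plan (g12) 22:28:34Z and (11)
22:37:20Z («(w2) minus the in-house fields, which ★1b already supplies»); LEAD F0P3a-plan (g12) T11-70∕71∕73; pen F0P2-p02 (g12).  THEOREMS ONLY (no def, no instance, no notation,
no `sorry`); ADDITIVE: ★ `F0P3KitOfRecordLawsV8` ∕ ★ `F0P3KitOfRecordLettersV8Cot` are untouched — these are their twins at ★1 `kitOfRecordW … μω wXi c …`.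

WHY TWINS AND NOT `Iff.rfl` (desk B2 amended, F0P2-ref1 (g9) r339): of the 21 v8 law rows, `UnitaryPacket` (#10: `expansion ≠ 0`) and `LocalExpansion` (#14: `sgnG`, `expansion`) READ
the two sign fields that ★1 makes per-ξ (`N ξ = N₀ + [wXi ξ = −1]`, `sgnG ξ = wXi ξ·c`), so `Laws (kitOfRecordW …)` is a different proposition from `Laws (kitOfRecord …)`; every
other row, `IsPinned`, and the six IN-HOUSE rows of ★ `laws₈_kitOfRecord_of₄` (#9 `UnitaryCoord`, #16 `TokenInf`, #17 `ArchPacketCoh`, #18 `ArchMember`, #19 `CptXiSpec`,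
#22 `LocalIsotypyFin` — ★ `F0P3ClassificationLawsV8` :150 :193 :201 :213 :226 :274 read no sign field) are DEFINITIONALLY the same at the two kits (★1b `…₈_kitOfRecordW` moves them
across by `Iff.rfl`; F0P3-p03 (g14)'s kernel probe 5ada654d0190fa95: 24∕26 predicates transport, the sign-bearing set is EXACTLY {`LocalExpansion`, `UnitaryPacket`}), and the
engine under the letters (★ V8-D `shapeGuarded_of_T5`, ★ B0 `letters_of_guardedEngine`) is kit-generic.  Row #10 at `𝔠₀^W` (★7 «UP-W») is ★1b `unitaryPacket_kitOfRecordW_of`.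
* §2 `laws₈_kitOfRecordW_of₄` (★ :129 twin: the fourteen hypotheses re-typed at the W kit; the six in-house rows BY NAME from ★1b `unitaryCoord₈_∕tokenInf₈_∕archPacketCoh₈_∕archMember₈_∕
  cptXiSpec₈_∕localIsotypyFin₈_kitOfRecordW`) + `routing₈_kitOfRecordW_of_v6`.
* §3 `lawsV8_kitFamilyOfRecordW_of`, `letters_of_kitFamilyOfRecordV8W` (★ :185 ∕ :206 twins) — `m(P) ≤ 1` on the cotangent locus ∧ E2′ `hodgeTypeRigid` from the W-family's LAWS.
* §4 `letters_of_specPkgV8W` (★ :237 twin, v6 routing conjunct) and `letters_of_specPkgV8W_cot` (★ `letters_of_specPkgV8_cot` twin, GUARDED routing conjunct = the aggregator's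
  `rows_of_rung0` text) — the HJ3a letters from `SpecPkg` + the fourteen NAMED rows at the W family (AGG ED. 38: `letters_of_rung0 := letters_of_specPkgV8W_cot frameDataOfRung0W …`).
Conclusion texts BYTE-VERBATIM = the ★ originals' (`StubE1coh` body ∧ `hodgeTypeRigid`).  `--supports stmt-HodgeConjecture-24833`.
HONEST LABEL: HC_CM is proved only modulo the printed citations until rung 0 closes; this file is count-neutral support (plumbing + transports, no new mathematics).

References: [Rogawski1990] §14.6 Thm. 14.6.4 pp. 236–244, §13.8 Prop. 13.8.1, §15.3 ¶1 p. 244, Prop. 15.2.1 (b), §12.2 p. 174, §12.3 p. 178, §13.1 Prop. 13.1.3 (d) p. 199;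
[Rogawski1992] Thm. 1.2 p. 397; [BorelWallach2000] VI Thm. 4.11; [FlathCorvallis1979] Thm. 3.
-/

set_option autoImplicit false
set_option linter.dupNamespace false

noncomputable section

open NumberField IsDedekindDomain MeasureTheory
open Literature.NumberTheory.Rogawski1990 Literature.NumberTheory.GaloisRepresentations
open Literature.NumberTheory.Automorphic Literature.NumberTheory.Automorphic.UnitaryGroup
open Literature.NumberTheory.Automorphic.UnitaryGroup.CotangentForms
open Literature.RepresentationTheory.BorelWallach2000 Literature.RepresentationTheory.KonnoKonno2007
open scoped Matrix ComplexOrder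
open Summit.HodgeConjecture.HodgeConjecture.Cruxes.H413.F0P3XiArchPacketOfRecord (JInfNoDegOne DsInfNoDegOne)

namespace Summit.HodgeConjecture.HodgeConjecture.Cruxes.H413.F0P3KitOfRecordW

open Summit.HodgeConjecture.HodgeConjecture.Cruxes.H413.F0P3InnerFormClassificationV6 (Sockets Gp Places Cinf IsCot KcTrivial)
open Summit.HodgeConjecture.HodgeConjecture.Cruxes.H413.F0P3ClassTokensOfRecord (Cls cl rep mult)
open Summit.HodgeConjecture.HodgeConjecture.Cruxes.H413.F0P3GuardedLettersOfGuardedShape (letters_of_guardedEngine)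
open Summit.HodgeConjecture.HodgeConjecture.Cruxes.H413.F0P3KitOfRecord

variable (L : Type) [Field L] [NumberField L] [IsCMField L] (H : Matrix (Fin 3) (Fin 3) L) (ι : L →+* ℂ) (T : GL (Fin 3) ℂ)
  (hT : (T : Matrix (Fin 3) (Fin 3) ℂ)ᴴ * H.map ι * (T : Matrix (Fin 3) (Fin 3) ℂ) = Literature.Geometry.ComplexHyperbolic.BallModel.J)
  (μ : Measure (Gp L H).automorphicQuotient) [(Gp L H).IsAutomorphicMeasure μ]
  [MeasurableSpace (Gp L H).Adelic] [BorelSpace (Gp L H).Adelic]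
  (𝔰 : Sockets L H μ) (gh : GHSide L H ι T hT 𝔰.PacketG 𝔰.PacketH) (ξd : XiSide L H 𝔰.PacketG 𝔰.PacketH)
  (μω : HeckeCharacter L) (hμu : μω.IsUnitary) (wXi : OneDimAutRepH L → ℤ) (c : ℚ) (jInf dsInf : ℤ → ℤ → ℤ → Cinf)
  (archTr : Cinf → (UnitaryGroup.arch (↥(maximalRealSubfield L)) L (IsCMField.complexConj L) 3 H → ℂ) → ℂ)
  (ν : Measure (Gp L H).Adelic) [IsFiniteMeasureOnCompacts ν]
  (μv : ∀ v : Places L, @Measure ((cmDatum L 3 H).Local v) (borel _))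
  (ramCls₀' : DiscreteAutomorphicRep (Gp L H) μ → Set (Places L))

/-! ## §2 The v8 `Laws` at `𝔠₀` from the fourteen remaining rows -/

/-- **`laws₈_kitOfRecordW_of₄`** (★ K7 ED. 3 `laws₈_kitOfRecord_of₄` twin AT THE W KIT): the v8 `Laws` (21 rows) of the W-kit of record from the FOURTEEN hypotheses #1 #2 #3 #4 #5 #6 #7 #8 #10 #13 #14 #15 (v8-guarded)
#20 #21 #23 (all v8 law texts at `𝔠₀`) + the arch clauses `hJ hD` and the `μω`-convention `hμω`; rows #9 #16 #17 #18 #19 #22 are ★ in-house (K7, K1′, p822835) — here BY NAME from ★1b `…₈_kitOfRecordW` (p847021).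
No `FlathDet`, no «AFA» (RULINGS (V43)(V44)). [cite: Rogawski1990, §14.6 Thm. 14.6.4 pp. 236–244; §13.8 Prop. 13.8.1; §15.3 ¶1] [cite: BorelWallach2000, VI Thm. 4.11] -/
theorem laws₈_kitOfRecordW_of₄ (S₀ : Finset (Places L))
    (hdef : ∀ τ' : L →+* ℂ, InfinitePlace.mk τ' ≠ InfinitePlace.mk ι → (H.map τ').PosDef) (h2 : 2 ≤ Module.finrank ℚ ↥(maximalRealSubfield L))
    (h1 : F0P3InnerFormClassificationV8.ClassificationKit.TraceIdentity (kitOfRecordW L H ι T hT μ 𝔰 gh ξd μω wXi c jInf dsInf archTr ν μv ramCls₀'))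
    (h2' : F0P3InnerFormClassificationV8.ClassificationKit.SpectralSideGp (kitOfRecordW L H ι T hT μ 𝔰 gh ξd μω wXi c jInf dsInf archTr ν μv ramCls₀'))
    (h3 : F0P3InnerFormClassificationV8.ClassificationKit.Factorisation (kitOfRecordW L H ι T hT μ 𝔰 gh ξd μω wXi c jInf dsInf archTr ν μv ramCls₀') S₀)
    (h4 : F0P3InnerFormClassificationV8.ClassificationKit.MatchingS (kitOfRecordW L H ι T hT μ 𝔰 gh ξd μω wXi c jInf dsInf archTr ν μv ramCls₀') S₀)
    (h5 : F0P3InnerFormClassificationV8.ClassificationKit.TransferS (kitOfRecordW L H ι T hT μ 𝔰 gh ξd μω wXi c jInf dsInf archTr ν μv ramCls₀') S₀)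
    (h6 : F0P3InnerFormClassificationV8.ClassificationKit.HatBounded (kitOfRecordW L H ι T hT μ 𝔰 gh ξd μω wXi c jInf dsInf archTr ν μv ramCls₀') S₀)
    (h7 : F0P3InnerFormClassificationV8.ClassificationKit.UnrStarAlgebra (kitOfRecordW L H ι T hT μ 𝔰 gh ξd μω wXi c jInf dsInf archTr ν μv ramCls₀') S₀)
    (h8 : F0P3InnerFormClassificationV8.ClassificationKit.LinIndepS (kitOfRecordW L H ι T hT μ 𝔰 gh ξd μω wXi c jInf dsInf archTr ν μv ramCls₀'))
    (h10 : F0P3InnerFormClassificationV8.ClassificationKit.UnitaryPacket (kitOfRecordW L H ι T hT μ 𝔰 gh ξd μω wXi c jInf dsInf archTr ν μv ramCls₀') S₀)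
    (h13 : F0P3InnerFormClassificationV8.ClassificationKit.APacketSpectral (kitOfRecordW L H ι T hT μ 𝔰 gh ξd μω wXi c jInf dsInf archTr ν μv ramCls₀') S₀)
    (h14 : F0P3InnerFormClassificationV8.ClassificationKit.LocalExpansion (kitOfRecordW L H ι T hT μ 𝔰 gh ξd μω wXi c jInf dsInf archTr ν μv ramCls₀') S₀)
    (h15 : F0P3InnerFormClassificationV8.ClassificationKit.Routing (kitOfRecordW L H ι T hT μ 𝔰 gh ξd μω wXi c jInf dsInf archTr ν μv ramCls₀'))
    (hμω : ∀ x : Literature.NumberTheory.GaloisRepresentations.ideleGroup ↥(maximalRealSubfield L),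
      μω (AdeleRing.ideleBaseChange (↥(maximalRealSubfield L)) L x) = quadraticHeckeCharCM L x)
    (hJ : JInfNoDegOne jInf) (hD : DsInfNoDegOne dsInf)
    (h20 : F0P3InnerFormClassificationV8.ClassificationKit.XiFamilyFin (kitOfRecordW L H ι T hT μ 𝔰 gh ξd μω wXi c jInf dsInf archTr ν μv ramCls₀') μω hμu)
    (h21 : F0P3InnerFormClassificationV8.ClassificationKit.XiUnram (kitOfRecordW L H ι T hT μ 𝔰 gh ξd μω wXi c jInf dsInf archTr ν μv ramCls₀'))
    (h23 : F0P3InnerFormClassificationV8.ClassificationKit.EvpConvention (kitOfRecordW L H ι T hT μ 𝔰 gh ξd μω wXi c jInf dsInf archTr ν μv ramCls₀')) :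
    F0P3InnerFormClassificationV8.ClassificationKit.Laws (kitOfRecordW L H ι T hT μ 𝔰 gh ξd μω wXi c jInf dsInf archTr ν μv ramCls₀') μω hμu S₀ where
  traceIdentity := h1
  spectralSideGp := h2'
  factorisation := h3
  matchingS := h4
  transferS := h5
  hatBounded := h6
  unrStarAlgebra := h7
  linIndepS := h8
  unitaryCoord := unitaryCoord₈_kitOfRecordW L H ι T hT μ 𝔰 gh ξd μω wXi c jInf dsInf archTr ν μv ramCls₀'
  unitaryPacket := h10
  aPacketSpectral := h13
  localExpansion := h14
  routing := h15
  tokenInf := tokenInf₈_kitOfRecordW L H ι T hT μ 𝔰 gh ξd μω wXi c jInf dsInf archTr ν μv ramCls₀' hdef h2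
  archPacketCoh := archPacketCoh₈_kitOfRecordW L H ι T hT μ 𝔰 gh ξd μω wXi c jInf dsInf archTr ν μv ramCls₀' hJ hD
  archMember := archMember₈_kitOfRecordW L H ι T hT μ 𝔰 gh ξd μω hμu wXi c jInf dsInf archTr ν μv ramCls₀' hμω hJ hD
  cptXiSpec := cptXiSpec₈_kitOfRecordW L H ι T hT μ 𝔰 gh ξd μω wXi c jInf dsInf archTr ν μv ramCls₀'
  xiFamilyFin := h20
  xiUnram := h21
  localIsotypyFin := localIsotypyFin₈_kitOfRecordW L H ι T hT μ 𝔰 gh ξd μω wXi c jInf dsInf archTr ν μv ramCls₀' hdef h2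
  evpConvention := h23

/-- **The same with row #15 `Routing` fed UNGUARDED** (the v6 text at `𝔠₀`, as ★ p823358 `routing_kitOfRecord` concludes it): `fun P _ _ => h P`.
[cite: Rogawski1990, §15.3 ¶1 p. 244; Thm. 13.3.6 (c)] -/
theorem routing₈_kitOfRecordW_of_v6
    (h : (kitOfRecordW L H ι T hT μ 𝔰 gh ξd μω wXi c jInf dsInf archTr ν μv ramCls₀').Routing) :
    F0P3InnerFormClassificationV8.ClassificationKit.Routing (kitOfRecordW L H ι T hT μ 𝔰 gh ξd μω wXi c jInf dsInf archTr ν μv ramCls₀') :=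
  fun P _ _ => h P

/-! ## §3 The family of record: v8 laws frame-wise, and the HJ3a LETTERS via the v8 head -/

section Family

/-- **Family-level v8 `Laws` from frame-wise v8 `Laws`** (★ V8-D `KitFamily.Laws` IS the frame-wise statement; `kitFamilyOfRecordW 𝔇W` is a v8 family by `rfl`).
[cite: Rogawski1990, §14.6 Thm. 14.6.4] -/
theorem lawsV8_kitFamilyOfRecordW_of
    (𝔇W : ∀ (L : Type) [Field L] [NumberField L] [IsCMField L] (ι : L →+* ℂ) (H : Matrix (Fin 3) (Fin 3) L) (T : GL (Fin 3) ℂ)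
      (hT : (T : Matrix (Fin 3) (Fin 3) ℂ)ᴴ * H.map ι * (T : Matrix (Fin 3) (Fin 3) ℂ) = Literature.Geometry.ComplexHyperbolic.BallModel.J),
      (∀ τ' : L →+* ℂ, InfinitePlace.mk τ' ≠ InfinitePlace.mk ι → (H.map τ').PosDef) →
      2 ≤ Module.finrank ℚ ↥(maximalRealSubfield L) →
      ∀ (μ : Measure (Gp L H).automorphicQuotient) [(Gp L H).IsAutomorphicMeasure μ] (μω : HeckeCharacter L) (_hμu : μω.IsUnitary),
      (∀ x : Literature.NumberTheory.GaloisRepresentations.ideleGroup ↥(maximalRealSubfield L),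
        μω (AdeleRing.ideleBaseChange (↥(maximalRealSubfield L)) L x) = quadraticHeckeCharCM L x) → FrameDataW L H ι T hT μ)
    (hL : ∀ (L : Type) [Field L] [NumberField L] [IsCMField L] (ι : L →+* ℂ) (H : Matrix (Fin 3) (Fin 3) L) (T : GL (Fin 3) ℂ)
      (hT : (T : Matrix (Fin 3) (Fin 3) ℂ)ᴴ * H.map ι * (T : Matrix (Fin 3) (Fin 3) ℂ) = Literature.Geometry.ComplexHyperbolic.BallModel.J)
      (hdef : ∀ τ' : L →+* ℂ, InfinitePlace.mk τ' ≠ InfinitePlace.mk ι → (H.map τ').PosDef) (h2 : 2 ≤ Module.finrank ℚ ↥(maximalRealSubfield L))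
      (μ : Measure (Gp L H).automorphicQuotient) [(Gp L H).IsAutomorphicMeasure μ] (μω : HeckeCharacter L) (hμu : μω.IsUnitary)
      (hμω : ∀ x : Literature.NumberTheory.GaloisRepresentations.ideleGroup ↥(maximalRealSubfield L),
        μω (AdeleRing.ideleBaseChange (↥(maximalRealSubfield L)) L x) = quadraticHeckeCharCM L x),
      ∃ S₀ : Finset (Places L), F0P3InnerFormClassificationV8.ClassificationKit.Laws (kitFamilyOfRecordW 𝔇W L ι H T hT hdef h2 μ μω hμu hμω) μω hμu S₀) :
    F0P3InnerFormClassificationV8.KitFamily.Laws (kitFamilyOfRecordW 𝔇W) :=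
  hL

/-- **THE HJ3a LINE'S LETTERS FROM THE v8 LAWS AT THE FAMILY OF RECORD** — `m(P) ≤ 1` on the cotangent locus at every compact CM frame, and E2′ `hodgeTypeRigid`:
★ B0 `letters_of_guardedEngine` ∘ ★ V8-D `shapeGuarded_of_T5` (same guarded conclusion text as v4–v6) at `kitFamilyOfRecordW 𝔇W`, pinned by ★ `isPinned_kitFamilyOfRecordW`
(v8 adds no pin). [cite: Rogawski1990, §14.6 Thm. 14.6.4; §15.3 ¶1; Prop. 15.2.1 (b)] [cite: BorelWallach2000, VI Thm. 4.11] -/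
theorem letters_of_kitFamilyOfRecordV8W
    (𝔇W : ∀ (L : Type) [Field L] [NumberField L] [IsCMField L] (ι : L →+* ℂ) (H : Matrix (Fin 3) (Fin 3) L) (T : GL (Fin 3) ℂ)
      (hT : (T : Matrix (Fin 3) (Fin 3) ℂ)ᴴ * H.map ι * (T : Matrix (Fin 3) (Fin 3) ℂ) = Literature.Geometry.ComplexHyperbolic.BallModel.J),
      (∀ τ' : L →+* ℂ, InfinitePlace.mk τ' ≠ InfinitePlace.mk ι → (H.map τ').PosDef) →
      2 ≤ Module.finrank ℚ ↥(maximalRealSubfield L) →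
      ∀ (μ : Measure (Gp L H).automorphicQuotient) [(Gp L H).IsAutomorphicMeasure μ] (μω : HeckeCharacter L) (_hμu : μω.IsUnitary),
      (∀ x : Literature.NumberTheory.GaloisRepresentations.ideleGroup ↥(maximalRealSubfield L),
        μω (AdeleRing.ideleBaseChange (↥(maximalRealSubfield L)) L x) = quadraticHeckeCharCM L x) → FrameDataW L H ι T hT μ)
    (hlaws : F0P3InnerFormClassificationV8.KitFamily.Laws (kitFamilyOfRecordW 𝔇W)) :
    (∀ (L : Type) [Field L] [NumberField L] [IsCMField L] (ι : L →+* ℂ) (H : Matrix (Fin 3) (Fin 3) L) (T : GL (Fin 3) ℂ)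
      (hT : (T : Matrix (Fin 3) (Fin 3) ℂ)ᴴ * H.map ι * (T : Matrix (Fin 3) (Fin 3) ℂ) = Literature.Geometry.ComplexHyperbolic.BallModel.J),
      (∀ τ' : L →+* ℂ, InfinitePlace.mk τ' ≠ InfinitePlace.mk ι → (H.map τ').PosDef) →
      2 ≤ Module.finrank ℚ ↥(maximalRealSubfield L) →
      ∀ (μ : Measure (adelicGroupData (↥(maximalRealSubfield L)) L (IsCMField.complexConj L) 3 H).automorphicQuotient)
        [(adelicGroupData (↥(maximalRealSubfield L)) L (IsCMField.complexConj L) 3 H).IsAutomorphicMeasure μ]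
        (P : DiscreteAutomorphicRep (adelicGroupData (↥(maximalRealSubfield L)) L (IsCMField.complexConj L) 3 H) μ),
        (P.IsHolCotangentAt (cmArchSection L ι H T hT) (cmCompactFactor L ι H T hT) ∨
          P.IsAntiholCotangentAt (cmArchSection L ι H T hT) (cmCompactFactor L ι H T hT)) →
        ((adelicGroupData (↥(maximalRealSubfield L)) L (IsCMField.complexConj L) 3 H).rightRegular μ).multiplicity
            P.space.toContRep ≤ 1) ∧
    Literature.NumberTheory.Rogawski1990.hodgeTypeRigid :=
  letters_of_guardedEngine (F0P3InnerFormClassificationV8.shapeGuarded_of_T5 (kitFamilyOfRecordW 𝔇W) (isPinned_kitFamilyOfRecordW 𝔇W) hlaws)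

end Family

/-! ## §4 K9α at v8 — the letters from `SpecPkg` + the remaining NAMED rows (fourteen conjuncts) -/

/-- **K9α AT v8 — `letters_of_specPkgV8`** (= ★ `letters_of_specPkg` re-based on the BOOKS PASS, RULINGS (V43)(V44)): for a family `𝔇W` of per-frame external data, IF at every
letters' frame the kit of record satisfies the witnessed package `SpecPkg` and the NAMED rows #1 (T1's head), TF, #2, #6, #7, #8 (L2-SA), #10, #15 (L3′, v6 text), the arch
clauses, and the ξ-rows #20 #21 #23 — FOURTEEN conjuncts at ONE level `S₀` per frame, no `FlathDet`, no «AFA» — THEN the HJ3a line's two letters hold (`letters_of_kitFamilyOfRecordV8W` ∘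
`laws₈_kitOfRecordW_of₄`). [cite: Rogawski1990, §14.6 Thm. 14.6.4 pp. 236–244; §15.3 ¶1; Prop. 15.2.1 (b)] [cite: BorelWallach2000, VI Thm. 4.11] -/
theorem letters_of_specPkgV8W
    (𝔇W : ∀ (L : Type) [Field L] [NumberField L] [IsCMField L] (ι : L →+* ℂ) (H : Matrix (Fin 3) (Fin 3) L) (T : GL (Fin 3) ℂ)
      (hT : (T : Matrix (Fin 3) (Fin 3) ℂ)ᴴ * H.map ι * (T : Matrix (Fin 3) (Fin 3) ℂ) = Literature.Geometry.ComplexHyperbolic.BallModel.J),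
      (∀ τ' : L →+* ℂ, InfinitePlace.mk τ' ≠ InfinitePlace.mk ι → (H.map τ').PosDef) →
      2 ≤ Module.finrank ℚ ↥(maximalRealSubfield L) →
      ∀ (μ : Measure (Gp L H).automorphicQuotient) [(Gp L H).IsAutomorphicMeasure μ] (μω : HeckeCharacter L) (_hμu : μω.IsUnitary),
      (∀ x : Literature.NumberTheory.GaloisRepresentations.ideleGroup ↥(maximalRealSubfield L),
        μω (AdeleRing.ideleBaseChange (↥(maximalRealSubfield L)) L x) = quadraticHeckeCharCM L x) → FrameDataW L H ι T hT μ)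
    (h : ∀ (L : Type) [Field L] [NumberField L] [IsCMField L] (ι : L →+* ℂ) (H : Matrix (Fin 3) (Fin 3) L) (T : GL (Fin 3) ℂ)
      (hT : (T : Matrix (Fin 3) (Fin 3) ℂ)ᴴ * H.map ι * (T : Matrix (Fin 3) (Fin 3) ℂ) = Literature.Geometry.ComplexHyperbolic.BallModel.J)
      (hdef : ∀ τ' : L →+* ℂ, InfinitePlace.mk τ' ≠ InfinitePlace.mk ι → (H.map τ').PosDef) (h2 : 2 ≤ Module.finrank ℚ ↥(maximalRealSubfield L))
      (μ : Measure (Gp L H).automorphicQuotient) [(Gp L H).IsAutomorphicMeasure μ] (μω : HeckeCharacter L) (hμu : μω.IsUnitary)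
      (hμω : ∀ x : Literature.NumberTheory.GaloisRepresentations.ideleGroup ↥(maximalRealSubfield L),
        μω (AdeleRing.ideleBaseChange (↥(maximalRealSubfield L)) L x) = quadraticHeckeCharCM L x),
      -- ONE level `S₀` per frame (v8, RULING (V44)); the witnessed package at `S₀` (K9β: `Classical.choose_spec`, unioned by `.mono`)
      ∃ S₀ : Finset (Places L),
      F0P3InnerFormClassificationV8.ClassificationKit.SpecPkg (kitFamilyOfRecordW 𝔇W L ι H T hT hdef h2 μ μω hμu hμω) S₀ ∧
      -- #1 (T1's head at the overridden kit, K9β §A), TF (class factorisation), #2, #6, #7, #8, #10, #15 (v6 text, UNGUARDED — ★ p823358)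
      (kitFamilyOfRecordW 𝔇W L ι H T hT hdef h2 μ μω hμu hμω).TraceIdentity ∧
      F0P3InnerFormClassificationV8.ClassificationKit.FactorisationCls (kitFamilyOfRecordW 𝔇W L ι H T hT hdef h2 μ μω hμu hμω) S₀ ∧
      (kitFamilyOfRecordW 𝔇W L ι H T hT hdef h2 μ μω hμu hμω).SpectralSideGp ∧
      F0P3InnerFormClassificationV8.ClassificationKit.HatBounded (kitFamilyOfRecordW 𝔇W L ι H T hT hdef h2 μ μω hμu hμω) S₀ ∧
      F0P3InnerFormClassificationV8.ClassificationKit.UnrStarAlgebra (kitFamilyOfRecordW 𝔇W L ι H T hT hdef h2 μ μω hμu hμω) S₀ ∧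
      (kitFamilyOfRecordW 𝔇W L ι H T hT hdef h2 μ μω hμu hμω).LinIndepS ∧
      F0P3InnerFormClassificationV8.ClassificationKit.UnitaryPacket (kitFamilyOfRecordW 𝔇W L ι H T hT hdef h2 μ μω hμu hμω) S₀ ∧
      (kitFamilyOfRecordW 𝔇W L ι H T hT hdef h2 μ μω hμu hμω).Routing ∧
      -- the arch clauses on the family's `jInf dsInf` (R-22′) and the ξ-rows #20 #21 #23 (no #12 `FlathDet`, no «AFA»: RULINGS (V43)(V44))
      JInfNoDegOne (𝔇W L ι H T hT hdef h2 μ μω hμu hμω).jInf ∧ DsInfNoDegOne (𝔇W L ι H T hT hdef h2 μ μω hμu hμω).dsInf ∧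
      (kitFamilyOfRecordW 𝔇W L ι H T hT hdef h2 μ μω hμu hμω).XiFamilyFin μω hμu ∧
      (kitFamilyOfRecordW 𝔇W L ι H T hT hdef h2 μ μω hμu hμω).XiUnram ∧
      (kitFamilyOfRecordW 𝔇W L ι H T hT hdef h2 μ μω hμu hμω).EvpConvention) :
    (∀ (L : Type) [Field L] [NumberField L] [IsCMField L] (ι : L →+* ℂ) (H : Matrix (Fin 3) (Fin 3) L) (T : GL (Fin 3) ℂ)
      (hT : (T : Matrix (Fin 3) (Fin 3) ℂ)ᴴ * H.map ι * (T : Matrix (Fin 3) (Fin 3) ℂ) = Literature.Geometry.ComplexHyperbolic.BallModel.J),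
      (∀ τ' : L →+* ℂ, InfinitePlace.mk τ' ≠ InfinitePlace.mk ι → (H.map τ').PosDef) →
      2 ≤ Module.finrank ℚ ↥(maximalRealSubfield L) →
      ∀ (μ : Measure (adelicGroupData (↥(maximalRealSubfield L)) L (IsCMField.complexConj L) 3 H).automorphicQuotient)
        [(adelicGroupData (↥(maximalRealSubfield L)) L (IsCMField.complexConj L) 3 H).IsAutomorphicMeasure μ]
        (P : DiscreteAutomorphicRep (adelicGroupData (↥(maximalRealSubfield L)) L (IsCMField.complexConj L) 3 H) μ),
        (P.IsHolCotangentAt (cmArchSection L ι H T hT) (cmCompactFactor L ι H T hT) ∨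
          P.IsAntiholCotangentAt (cmArchSection L ι H T hT) (cmCompactFactor L ι H T hT)) →
        ((adelicGroupData (↥(maximalRealSubfield L)) L (IsCMField.complexConj L) 3 H).rightRegular μ).multiplicity
            P.space.toContRep ≤ 1) ∧
    Literature.NumberTheory.Rogawski1990.hodgeTypeRigid := by
  refine letters_of_kitFamilyOfRecordV8W 𝔇W fun L _ _ _ ι H T hT hdef h2 μ _ μω hμu hμω => ?_
  obtain ⟨S₀, hpk, h1, hTF, h2', h6, h7, h8, h10, h15, hJ, hD, h20, h21, h23⟩ := h L ι H T hT hdef h2 μ μω hμu hμω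
  letI : MeasurableSpace (Gp L H).Adelic := borel _
  haveI : BorelSpace (Gp L H).Adelic := ⟨rfl⟩
  haveI := (𝔇W L ι H T hT hdef h2 μ μω hμu hμω).isFiniteMeasureOnCompacts_ν
  exact ⟨S₀, laws₈_kitOfRecordW_of₄ L H ι T hT μ _ _ _ μω hμu _ _ _ _ _ _ _ _ S₀ hdef h2 h1 h2'
    (F0P3InnerFormClassificationV8.ClassificationKit.factorisation_of_cls_of_pk _ hTF hpk.factorisationPk) hpk.matchingS hpk.transferS h6 h7 h8 h10
    hpk.aPacketSpectral hpk.localExpansion (routing₈_kitOfRecordW_of_v6 L H ι T hT μ _ _ _ μω _ _ _ _ _ _ _ _ h15) hμω hJ hD h20 h21 h23⟩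


/-- **K9α AT v8, GUARDED ROUTING — `letters_of_specPkgV8W_cot`**: for a family `𝔇W` of per-frame external data, IF at every letters' frame the kit of record satisfies the
witnessed package `SpecPkg` and the NAMED rows #1, TF, #2, #6, #7, #8, #10, #15 IN ITS GUARDED v8 TEXT (`IsCot P → KcTrivial P → …`), the arch clauses and the ξ-rows
#20 #21 #23 — fourteen conjuncts at ONE level `S₀` per frame — THEN the HJ3a line's two letters hold (★ `letters_of_kitFamilyOfRecordV8W` ∘ ★ `laws₈_kitOfRecordW_of₄`, whose
`h15` IS the guarded row).  Same as ★ `letters_of_specPkgV8` except conjunct 9. [cite: Rogawski1990, §14.6 Thm. 14.6.4 pp. 236–244; §15.3 ¶1 p. 244; Prop. 15.2.1 (b)]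
[cite: BorelWallach2000, VI Thm. 4.11] -/
theorem letters_of_specPkgV8W_cot
    (𝔇W : ∀ (L : Type) [Field L] [NumberField L] [IsCMField L] (ι : L →+* ℂ) (H : Matrix (Fin 3) (Fin 3) L) (T : GL (Fin 3) ℂ)
      (hT : (T : Matrix (Fin 3) (Fin 3) ℂ)ᴴ * H.map ι * (T : Matrix (Fin 3) (Fin 3) ℂ) = Literature.Geometry.ComplexHyperbolic.BallModel.J),
      (∀ τ' : L →+* ℂ, InfinitePlace.mk τ' ≠ InfinitePlace.mk ι → (H.map τ').PosDef) →
      2 ≤ Module.finrank ℚ ↥(maximalRealSubfield L) →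
      ∀ (μ : Measure (Gp L H).automorphicQuotient) [(Gp L H).IsAutomorphicMeasure μ] (μω : HeckeCharacter L) (_hμu : μω.IsUnitary),
      (∀ x : Literature.NumberTheory.GaloisRepresentations.ideleGroup ↥(maximalRealSubfield L),
        μω (AdeleRing.ideleBaseChange (↥(maximalRealSubfield L)) L x) = quadraticHeckeCharCM L x) → FrameDataW L H ι T hT μ)
    (h : ∀ (L : Type) [Field L] [NumberField L] [IsCMField L] (ι : L →+* ℂ) (H : Matrix (Fin 3) (Fin 3) L) (T : GL (Fin 3) ℂ)
      (hT : (T : Matrix (Fin 3) (Fin 3) ℂ)ᴴ * H.map ι * (T : Matrix (Fin 3) (Fin 3) ℂ) = Literature.Geometry.ComplexHyperbolic.BallModel.J)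
      (hdef : ∀ τ' : L →+* ℂ, InfinitePlace.mk τ' ≠ InfinitePlace.mk ι → (H.map τ').PosDef) (h2 : 2 ≤ Module.finrank ℚ ↥(maximalRealSubfield L))
      (μ : Measure (Gp L H).automorphicQuotient) [(Gp L H).IsAutomorphicMeasure μ] (μω : HeckeCharacter L) (hμu : μω.IsUnitary)
      (hμω : ∀ x : Literature.NumberTheory.GaloisRepresentations.ideleGroup ↥(maximalRealSubfield L),
        μω (AdeleRing.ideleBaseChange (↥(maximalRealSubfield L)) L x) = quadraticHeckeCharCM L x),
      -- ONE level `S₀` per frame (v8, RULING (V44)); the witnessed package at `S₀` (K9β: `Classical.choose_spec`, unioned by `.mono`)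
      ∃ S₀ : Finset (Places L),
      F0P3InnerFormClassificationV8.ClassificationKit.SpecPkg (kitFamilyOfRecordW 𝔇W L ι H T hT hdef h2 μ μω hμu hμω) S₀ ∧
      -- #1 (T1's head at the overridden kit, K9β §A), TF (class factorisation), #2, #6, #7, #8, #10, #15 (v8 text, GUARDED `IsCot P → KcTrivial P → …` — ★ `routing₈_kitOfRecord_of_cot`)
      (kitFamilyOfRecordW 𝔇W L ι H T hT hdef h2 μ μω hμu hμω).TraceIdentity ∧
      F0P3InnerFormClassificationV8.ClassificationKit.FactorisationCls (kitFamilyOfRecordW 𝔇W L ι H T hT hdef h2 μ μω hμu hμω) S₀ ∧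
      (kitFamilyOfRecordW 𝔇W L ι H T hT hdef h2 μ μω hμu hμω).SpectralSideGp ∧
      F0P3InnerFormClassificationV8.ClassificationKit.HatBounded (kitFamilyOfRecordW 𝔇W L ι H T hT hdef h2 μ μω hμu hμω) S₀ ∧
      F0P3InnerFormClassificationV8.ClassificationKit.UnrStarAlgebra (kitFamilyOfRecordW 𝔇W L ι H T hT hdef h2 μ μω hμu hμω) S₀ ∧
      (kitFamilyOfRecordW 𝔇W L ι H T hT hdef h2 μ μω hμu hμω).LinIndepS ∧
      F0P3InnerFormClassificationV8.ClassificationKit.UnitaryPacket (kitFamilyOfRecordW 𝔇W L ι H T hT hdef h2 μ μω hμu hμω) S₀ ∧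
      F0P3InnerFormClassificationV8.ClassificationKit.Routing (kitFamilyOfRecordW 𝔇W L ι H T hT hdef h2 μ μω hμu hμω) ∧
      -- the arch clauses on the family's `jInf dsInf` (R-22′) and the ξ-rows #20 #21 #23 (no #12 `FlathDet`, no «AFA»: RULINGS (V43)(V44))
      JInfNoDegOne (𝔇W L ι H T hT hdef h2 μ μω hμu hμω).jInf ∧ DsInfNoDegOne (𝔇W L ι H T hT hdef h2 μ μω hμu hμω).dsInf ∧
      (kitFamilyOfRecordW 𝔇W L ι H T hT hdef h2 μ μω hμu hμω).XiFamilyFin μω hμu ∧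
      (kitFamilyOfRecordW 𝔇W L ι H T hT hdef h2 μ μω hμu hμω).XiUnram ∧
      (kitFamilyOfRecordW 𝔇W L ι H T hT hdef h2 μ μω hμu hμω).EvpConvention) :
    (∀ (L : Type) [Field L] [NumberField L] [IsCMField L] (ι : L →+* ℂ) (H : Matrix (Fin 3) (Fin 3) L) (T : GL (Fin 3) ℂ)
      (hT : (T : Matrix (Fin 3) (Fin 3) ℂ)ᴴ * H.map ι * (T : Matrix (Fin 3) (Fin 3) ℂ) = Literature.Geometry.ComplexHyperbolic.BallModel.J),
      (∀ τ' : L →+* ℂ, InfinitePlace.mk τ' ≠ InfinitePlace.mk ι → (H.map τ').PosDef) →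
      2 ≤ Module.finrank ℚ ↥(maximalRealSubfield L) →
      ∀ (μ : Measure (adelicGroupData (↥(maximalRealSubfield L)) L (IsCMField.complexConj L) 3 H).automorphicQuotient)
        [(adelicGroupData (↥(maximalRealSubfield L)) L (IsCMField.complexConj L) 3 H).IsAutomorphicMeasure μ]
        (P : DiscreteAutomorphicRep (adelicGroupData (↥(maximalRealSubfield L)) L (IsCMField.complexConj L) 3 H) μ),
        (P.IsHolCotangentAt (cmArchSection L ι H T hT) (cmCompactFactor L ι H T hT) ∨
          P.IsAntiholCotangentAt (cmArchSection L ι H T hT) (cmCompactFactor L ι H T hT)) →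
        ((adelicGroupData (↥(maximalRealSubfield L)) L (IsCMField.complexConj L) 3 H).rightRegular μ).multiplicity
            P.space.toContRep ≤ 1) ∧
    Literature.NumberTheory.Rogawski1990.hodgeTypeRigid := by
  refine letters_of_kitFamilyOfRecordV8W 𝔇W fun L _ _ _ ι H T hT hdef h2 μ _ μω hμu hμω => ?_
  obtain ⟨S₀, hpk, h1, hTF, h2', h6, h7, h8, h10, h15, hJ, hD, h20, h21, h23⟩ := h L ι H T hT hdef h2 μ μω hμu hμω
  letI : MeasurableSpace (Gp L H).Adelic := borel _
  haveI : BorelSpace (Gp L H).Adelic := ⟨rfl⟩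
  haveI := (𝔇W L ι H T hT hdef h2 μ μω hμu hμω).isFiniteMeasureOnCompacts_ν
  exact ⟨S₀, laws₈_kitOfRecordW_of₄ L H ι T hT μ _ _ _ μω hμu _ _ _ _ _ _ _ _ S₀ hdef h2 h1 h2'
    (F0P3InnerFormClassificationV8.ClassificationKit.factorisation_of_cls_of_pk _ hTF hpk.factorisationPk) hpk.matchingS hpk.transferS h6 h7 h8 h10
    hpk.aPacketSpectral hpk.localExpansion h15 hμω hJ hD h20 h21 h23⟩

end Summit.HodgeConjecture.HodgeConjecture.Cruxes.H413.F0P3KitOfRecordW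

end
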